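import Literature.IUT.HodgeArakelov.LabelClassesOfCuspsCor24iGraphTower
import Literature.IUT.HodgeArakelov.LabelClassesOfCuspsCor24iOfSpecialFibre
import HarnessLib

/-!
# [IUTchII] Cor 2.4 (i), inputs (B)+(C) over an admissible tower: Def 2.3 (ii)′ RELAXED to its conjunct 2, and the genuine pair

S. Mochizuki, *Inter-universal Teichmüller Theory II*, kurims manuscript (Dec. 2020), §2, Def 2.3 (ii) p. 68, Cor 2.4 (i) proof p. 70
l. −2 – p. 71 l. 4 («by applying the equivalence of [IUTchI], Corollary 2.3, (vi) …, to the various finite index open subgroups of `Δ^±_v`,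
it follows that `γ' ∈ Δ̂^±_{v□}` … hence `γ' ∈ Δ^±_{v□}`»); *… I* (May 2020), §2, Cor 2.3 (i)/(ii)/(v)/(vi) pp. 47–48, Prop 2.4 (i) p. 50
[cite: Mochizuki2012, II Cor 2.4 (i) pp.70–71] (D-0012 claim key, status DISPUTED: every [IUTchI]/[IUTchII]/[SemiAnbd] statement below is a
HYPOTHESIS named by the tree's typed predicates or a kernel theorem about the tree's own constructions; nothing printed is asserted).

abc-iut cell, node **IUTchII:Cor2.4(i)** (CONE-BOARD claimant abc-iut-w4-d012; gen 6), GAP-LEDGER **G-w4d012-2** (the open-subgroup step (B)).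
PROOF-ONLY (no `def`/`instance`/`structure`).  abc-iut-w5-d121's level-based reductions of (B)+(C) (`levelStatement_of_subgraphLevelData`,
`mem_deltaPmBox_of_subgraphLevelData`, `mem_deltaPmBox_of_coveringLevelGraphs` p420922; `mem_deltaPmBox_of_graphTower`, GraphTower file) bind
the FULL repaired Def 2.3 (ii)′ `Def23_ii' C W.piV W.piPM` but USE ONLY the forward direction of its conjunct 2 («a cuspidal inertia group of
`Π_v` is `I' ∩ Π_v` for a cuspidal `I'` of `Π^±_v`»).  At the GENUINE pair (part 2, `LabelClassesOfCuspsCor24iGenuine.lean`) that conjunct is a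
THEOREM (`PlusMinusTower.hrel₂_of_levelClause`, from the level clause of abc-iut-w5-d028's transported cuspidal datum + `[Π^±_v : Π_v] = l`),
whereas conjunct 3 («the cuspidal inertia groups of `Π^±_v` are the `Π^±_v`-conjugates of the normalisers of those of `Π_v`») is NOT
(commensurable terminality of cuspidal inertia in `Δ^tp`, an input).  This file re-derives the four reductions with `Def23_ii'` RELAXED to
`hrel₂` (same proofs, one line changed — § 1), and then instantiates them:

* § 1 `levelStatement_of_subgraphLevelData_of_hrel₂`, `mem_deltaPmBox_of_subgraphLevelData_of_hrel₂`,
  `mem_deltaPmBox_of_coveringLevelGraphs_of_hrel₂`, `mem_deltaPmBox_of_graphTower_of_hrel₂` (generic, universe `u`);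
* § 2 `hBC_ofSpecialFibre_graphTower` — for ANY tower `W` (transported cuspidal datum, `[Π^±_v : Π_v] < ∞`, `Π^±_v ∩ Π̂_v ⊆ Π_v`) agreeing
  bicontinuously with the [IUTchI] §2 datum `ofSpecialFibre X d Sf …` of a tempered curve with special-fibre data: the FUSED inputs (B)+(C)
  («for `γ' ∈ Δ^±_v`: `I^{γ'}_t ⊆ Π^±_{v□} ⟹ γ' ∈ Δ^±_{v□}`») for a `Π_{v□}` MODULO, for SOME sub-graph `Π^tp_{ℍ'}` (`Π̂_{ℍ'}` its closure,
  `hH'`): the Δ-dictionary identity, [IUTchI] Cor 2.3 (v) of that datum, an ADMISSIBLE tower of it (`Tw`, levels `ρ̂⁻¹(V_i)` of open normal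
  `V_i ⊆ Π̂_𝔾` shrinking to `1`) realised by coverings of semi-graphs (abc-iut-w4-d076 `CoveringLevelGraphs`) whose level data satisfy [IUTchI]
  Cor 2.3 (vi) BY NAME, the (D3) stabiliser statement, and «levels below `Π̂_v`» — the agreement, its re-graphing to `ℍ'`, `hrel₂`, the density
  `Π^tp_{ℍ'} ↪ Π̂_{ℍ'}` and the closedness of `Π̂_{ℍ'}` being DISCHARGED; `cor24_i_ofSpecialFibre_graphTower` — the landed predicate
  `Cor24_i W Cu H I` from that and input (A) (part 1, modulo [IUTchI] Prop 2.4 (i));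
* (SEQUEL, separate file `LabelClassesOfCuspsCor24iGenuineGraphTower.lean`, not in this file) `cor24_i'_ofPiCHat_of_graphTower` — AT THE
  GENUINE PAIR (abc-iut-L6-t19's `ofPiCHat`, `X̲_v`; part 2 + `PlusMinusTowerCoverModelTempered` for `Π^±_v ∩ Π̂_v = Π_v`): the decl of record
  `Cor24_i' Dec (ofPiCHat …) Cu Ld I` for every `I ⊆ Δ̂^cor_v` MODULO ONLY [IUTchI] Prop 2.4 (i) of `X̲_v`'s datum and, per admissible `□`, the
  sub-graph/admissible-tower data just listed (L3/L5 statements about the special fibre of `X̲_v` and the Δ-dictionary identity naming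
  `□ ↔ ℍ'`) — no tower-side binder is left except `hZ`, `hN`, `hDopen`.

HONEST LABEL: kernel reductions; the per-level [IUTchI] Cor 2.3 (v)/(vi), Prop 2.4 (i), the (D3) stabilisers and the admissible tower at the
special-fibre datum are NAMED inputs (L5 nodes / plan/L5/SUBDAG-IUTchI-Cor23Levels.md rows), not proved here; G-w4d012-2 stays open as a row.
Nothing here takes a side on [IUTchIII] Cor 3.12 or asserts anything of the series.
-/

noncomputable section

universe u

/-! ## § 1. The (B)+(C) reductions with Def 2.3 (ii)′ relaxed to its conjunct 2 -/

namespace Literature.IUT.HodgeArakelov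

open Literature.IUT.HodgeTheaters Literature.AnabelianGeometry.SemiGraphs
open _root_.Topology
open scoped Pointwise

namespace PlusMinusTower

namespace StableCurveAgreement

section Relaxed

variable {S : BadPlaceSetting.{u}} {P : TopGroup.{u}} {T : TemperedCoverings S P}
  {W : PlusMinusTower T} {C : CuspidalInertiaData W} {D : StableCurveTemperedData.{u}}

/-- **IUTchII:Cor2.4(i)** (kurims p.70 l.−2 – p.71 l.3, ONE level) — abc-iut-w5-d121's `levelStatement_of_subgraphLevelData` (p420922) with
`Def23_ii'` RELAXED to its conjunct 2 `hrel₂` (the only part used).  Same proof.  PROVED. [claim: Mochizuki2012, status: disputed] -/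
theorem levelStatement_of_subgraphLevelData_of_hrel₂ (A : StableCurveAgreement W C D) {H : Subgroup P}
    (Dic : A.SubgraphDictionary H) (Tw : D.Prop24Tower) (Lv : Tw.SubgraphLevelData) (hN : Tw.LevelsNormal)
    (hinc : Lv.LevelIncidence) (hblk : Lv.IsBlock) (hstab : Lv.StabLeDeltaHLevel)
    (hlevV : ∀ i, Tw.Jhat i ≤ (W.hat.subgroupOf W.pmHat).map A.eHat.toMonoidHom)
    (hinf : W.piPM ⊓ W.hat ≤ W.piV)
    (hrel₂ : ∀ I, C.IsCuspidalInertia W.piV I →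
      ∃ I', C.IsCuspidalInertia W.piPM I' ∧ ((I' ⊓ W.piV).subgroupOf I').FiniteIndex ∧ I = I' ⊓ W.piV)
    {I : Subgroup W.Corhat} (hI : C.IsCuspidalInertia W.piV I) (hIΔ : I ≤ W.deltaBox H)
    {γ' : W.Corhat} (hγ' : γ' ∈ W.piPM ⊓ W.aug.ker) (hc : I.map (MulAut.conj γ').toMonoidHom ≤ W.pmBox H)
    (hγ'pm : γ' ∈ W.pmHat) (γ : D.DeltaTp) (hγ : D.ιX (γ : D.PiTp) = A.eHat ⟨γ', hγ'pm⟩) (i : Tw.I) :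
    ∃ k ∈ D.deltaTpH, k⁻¹ * γ ∈ D.levelTp (Tw.Jhat i) := by
  obtain ⟨I', hI', -, hII'⟩ := hrel₂ I hI
  obtain ⟨hI'pm, x, t, hK⟩ := (A.inertia_iff I').mp hI'
  obtain ⟨hγ'pm', hγ'ker⟩ := Subgroup.mem_inf.mp hγ'
  set g' : D.PiHat := A.eHat ⟨γ', hγ'pm⟩ with hg'
  have hg'tp : g' ∈ D.ιX.range := (A.mem_piPM_iff ⟨γ', hγ'pm⟩).mp hγ'pm'
  have hg'Δ : g' ∈ D.DeltaHat := (A.mem_ker_iff ⟨γ', hγ'pm⟩).mp hγ'ker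
  set J : Subgroup D.PiHat := (I.subgroupOf W.pmHat).map A.eHat.toMonoidHom with hJ
  have dic : ∀ q : W.pmHat, (q : W.Corhat) ∈ W.deltaPmBox H →
      A.eHat q ∈ (D.deltaTpH.map D.ιΔ).map D.DeltaHat.subtype := by
    intro q hq
    rw [← Dic.deltaPmBox_eq]
    exact ⟨q, Subgroup.mem_subgroupOf.mpr hq, rfl⟩
  have hIΔ' : I ≤ W.deltaPmBox H := hIΔ.trans (W.deltaBox_le_deltaPmBox H)
  -- (1) the level-`i` inertia group of the cusp `t·x̃` lies in `J`
  have h1 : (MulAut.conj t • ((D.inertiaTp x).map D.DeltaTp.subtype)).map D.ιX ⊓ Tw.Jhat i ≤ J := by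
    rintro y ⟨hy1, hy2⟩
    rw [← hK] at hy1
    obtain ⟨q, hq, rfl⟩ := hy1
    have hqI' : (q : W.Corhat) ∈ I' := Subgroup.mem_subgroupOf.mp hq
    obtain ⟨q₁, hq₁, hqq₁⟩ := hlevV i hy2
    rw [MulEquiv.coe_toMonoidHom, A.eHat.apply_eq_iff_eq] at hqq₁
    subst hqq₁
    have hqV : (q₁ : W.Corhat) ∈ W.piV := hinf ⟨hI'pm hqI', Subgroup.mem_subgroupOf.mp hq₁⟩
    refine ⟨q₁, Subgroup.mem_subgroupOf.mpr ?_, rfl⟩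
    rw [hII']
    exact ⟨hqI', hqV⟩
  -- (2) `J ⊆ ι(Δ^tp_{X,ℍ})`
  have h2 : J ≤ (D.deltaTpH.map D.ιΔ).map D.DeltaHat.subtype := by
    rintro _ ⟨q, hq, rfl⟩
    exact dic q (hIΔ' (Subgroup.mem_subgroupOf.mp hq))
  -- (3) `J^{g'} ⊆ ι(Δ^tp_{X,ℍ})`
  have hcs : MulAut.conj γ' • I ≤ W.pmBox H := by rw [← map_conj_eq_smul]; exact hc
  have h3 : MulAut.conj g' • J ≤ (D.deltaTpH.map D.ιΔ).map D.DeltaHat.subtype := by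
    rw [hJ, hg', ← map_subgroupOf_conj A.eHat I hγ'pm]
    rintro _ ⟨q, hq, rfl⟩
    have hq' : (q : W.Corhat) ∈ MulAut.conj γ' • I := Subgroup.mem_subgroupOf.mp hq
    refine dic q (Subgroup.mem_inf.mpr ⟨hcs hq', ?_⟩)
    have hz : (MulAut.conj γ')⁻¹ • (q : W.Corhat) ∈ W.aug.ker :=
      (Subgroup.mem_inf.mp (hIΔ' (Subgroup.mem_pointwise_smul_iff_inv_smul_mem.mp hq'))).2
    rw [MulAut.smul_def, MulAut.conj_inv_apply] at hz
    have e : (q : W.Corhat) = γ' * (γ'⁻¹ * q * γ') * γ'⁻¹ := by group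
    rw [e]
    exact W.aug.ker.mul_mem (W.aug.ker.mul_mem hγ'ker hz) (W.aug.ker.inv_mem hγ'ker)
  obtain ⟨k', hk', hkU⟩ := Lv.levelTarget_sub_hat hN hinc hblk hstab i x t J h1 h2 hg'tp hg'Δ h3
  -- read `k' ∈ ι(Δ^tp_{X,ℍ})`, `k'⁻¹ g' ∈ Ĵ_i` back in `Δ^tp_X`
  obtain ⟨_, ⟨k, hk, rfl⟩, rfl⟩ := hk'
  refine ⟨k, hk, (D.mem_levelTp).mpr ?_⟩
  have e2 : D.ιX ((k⁻¹ * γ : D.DeltaTp) : D.PiTp) = (D.DeltaHat.subtype (D.ιΔ k))⁻¹ * g' := by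
    rw [Subgroup.coe_mul, Subgroup.coe_inv, map_mul, map_inv, hγ]
    rfl
  rw [e2]
  exact hkU

/-- **IUTchII:Cor2.4(i)** (kurims p.70 l.−2 – p.71 l.4) — abc-iut-w5-d121's `mem_deltaPmBox_of_subgraphLevelData` (p420922) with `Def23_ii'`
RELAXED to `hrel₂`: inputs (B)+(C) over admissible levels, `γ' ∈ Δ^±_{v□}` outright.  Same proof.  PROVED.
[claim: Mochizuki2012, status: disputed] -/
theorem mem_deltaPmBox_of_subgraphLevelData_of_hrel₂ (A : StableCurveAgreement W C D) {H : Subgroup P}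
    (Dic : A.SubgraphDictionary H) (Tw : D.Prop24Tower) (Lv : Tw.SubgraphLevelData) (hN : Tw.LevelsNormal)
    (hinc : Lv.LevelIncidence) (hblk : Lv.IsBlock) (hstab : Lv.StabLeDeltaHLevel)
    (hU : ∀ O ∈ 𝓝 (1 : D.graph.Hat), ∃ i, ∀ d ∈ D.levelTp (Tw.Jhat i), D.graph.ι (D.ρTp d) ∈ O)
    (hHatH : IsClosed (D.graph.HatH : Set D.graph.Hat)) (h23vD : D.Cor23v)
    (hlevV : ∀ i, Tw.Jhat i ≤ (W.hat.subgroupOf W.pmHat).map A.eHat.toMonoidHom)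
    (hinf : W.piPM ⊓ W.hat ≤ W.piV)
    (hrel₂ : ∀ I, C.IsCuspidalInertia W.piV I →
      ∃ I', C.IsCuspidalInertia W.piPM I' ∧ ((I' ⊓ W.piV).subgroupOf I').FiniteIndex ∧ I = I' ⊓ W.piV)
    {I : Subgroup W.Corhat} (hI : C.IsCuspidalInertia W.piV I) (hIΔ : I ≤ W.deltaBox H) :
    ∀ γ' : W.Corhat, γ' ∈ W.piPM ⊓ W.aug.ker →
      I.map (MulAut.conj γ').toMonoidHom ≤ W.pmBox H → γ' ∈ W.deltaPmBox H := by
  intro γ' hγ' hc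
  obtain ⟨hγ'pm', hγ'ker⟩ := Subgroup.mem_inf.mp hγ'
  have hγ'pm : γ' ∈ W.pmHat := W.emb_le_pmHat hγ'pm'
  obtain ⟨γ, hγ⟩ := StableCurveTemperedData.exists_deltaTp_of_mem_range_of_mem_deltaHat
    ((A.mem_piPM_iff ⟨γ', hγ'pm⟩).mp hγ'pm') ((A.mem_ker_iff ⟨γ', hγ'pm⟩).mp hγ'ker)
  have hγH : γ ∈ D.deltaTpH := by
    refine StableCurveTemperedData.mem_deltaTpH_of_graphLevels h23vD hHatH
      (fun i => (D.levelTp (Tw.Jhat i)).map (D.graph.ι.comp D.ρTp)) (fun O hO => ?_) γ (fun i => ?_)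
    · obtain ⟨i, hi⟩ := hU O hO
      refine ⟨i, ?_⟩
      rintro _ ⟨d, hd, rfl⟩
      exact hi d hd
    · obtain ⟨k, hk, hj⟩ := A.levelStatement_of_subgraphLevelData_of_hrel₂ Dic Tw Lv hN hinc hblk hstab hlevV hinf hrel₂
        hI hIΔ hγ' hc hγ'pm γ hγ i
      exact ⟨k, hk, ⟨k⁻¹ * γ, hj, rfl⟩⟩
  have hmem : A.eHat ⟨γ', hγ'pm⟩ ∈ ((W.deltaPmBox H).subgroupOf W.pmHat).map A.eHat.toMonoidHom := by
    rw [Dic.deltaPmBox_eq, ← hγ]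
    exact ⟨D.ιΔ γ, ⟨γ, hγH, rfl⟩, rfl⟩
  obtain ⟨q, hq, hqe⟩ := hmem
  rw [MulEquiv.coe_toMonoidHom, A.eHat.apply_eq_iff_eq] at hqe
  have : (q : W.Corhat) = γ' := congrArg Subtype.val hqe
  rw [← this]
  exact Subgroup.mem_subgroupOf.mp hq

/-- **IUTchII:Cor2.4(i)** (kurims pp.70–71) — abc-iut-w5-d121's `mem_deltaPmBox_of_coveringLevelGraphs` with `Def23_ii'` RELAXED to `hrel₂`
([IUTchI] Cor 2.3 (vi) BY NAME at every level via abc-iut-w4-d076's `CoveringLevelGraphs`).  PROVED. [claim: Mochizuki2012, status: disputed] -/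
theorem mem_deltaPmBox_of_coveringLevelGraphs_of_hrel₂ (A : StableCurveAgreement W C D) {H : Subgroup P}
    (Dic : A.SubgraphDictionary H) (Tw : D.Prop24Tower) (Cv : Tw.CoveringLevelGraphs)
    (Ad : ∀ i, Cv.toLevelData.LevelDatum i) (h23vi : ∀ i, (Ad i).lev.Cor23vi) (hN : Tw.LevelsNormal)
    (hstab : Cv.toLevelData.StabLeDeltaHLevel)
    (hU : ∀ O ∈ 𝓝 (1 : D.graph.Hat), ∃ i, ∀ d ∈ D.levelTp (Tw.Jhat i), D.graph.ι (D.ρTp d) ∈ O)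
    (hHatH : IsClosed (D.graph.HatH : Set D.graph.Hat)) (h23vD : D.Cor23v)
    (hlevV : ∀ i, Tw.Jhat i ≤ (W.hat.subgroupOf W.pmHat).map A.eHat.toMonoidHom)
    (hinf : W.piPM ⊓ W.hat ≤ W.piV)
    (hrel₂ : ∀ I, C.IsCuspidalInertia W.piV I →
      ∃ I', C.IsCuspidalInertia W.piPM I' ∧ ((I' ⊓ W.piV).subgroupOf I').FiniteIndex ∧ I = I' ⊓ W.piV)
    {I : Subgroup W.Corhat} (hI : C.IsCuspidalInertia W.piV I) (hIΔ : I ≤ W.deltaBox H) :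
    ∀ γ' : W.Corhat, γ' ∈ W.piPM ⊓ W.aug.ker →
      I.map (MulAut.conj γ').toMonoidHom ≤ W.pmBox H → γ' ∈ W.deltaPmBox H :=
  A.mem_deltaPmBox_of_subgraphLevelData_of_hrel₂ Dic Tw Cv.toLevelData hN (Cv.toLevelData.levelIncidence_of_cor23vi Ad h23vi)
    Cv.toLevelData_isBlock hstab hU hHatH h23vD hlevV hinf hrel₂ hI hIΔ

/-- **IUTchII:Cor2.4(i)** (kurims pp.70–71) — `mem_deltaPmBox_of_graphTower` (GraphTower file) with `Def23_ii'` RELAXED to `hrel₂`: inputs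
(B)+(C) over an ADMISSIBLE tower (`Ĵ_i ∩ Δ̂_X = ρ̂⁻¹(V_i)`, `V_i ⊴ Π̂_𝔾` open, shrinking to `1`), everything except Cor 2.3 (v)/(vi) and the
dictionaries reduced to `Π_𝔾`-level statements ((D3) stabilisers, density, closedness).  PROVED. [claim: Mochizuki2012, status: disputed] -/
theorem mem_deltaPmBox_of_graphTower_of_hrel₂ (A : StableCurveAgreement W C D) {H : Subgroup P}
    (Dic : A.SubgraphDictionary H) (Tw : D.Prop24Tower) (V : Tw.I → Subgroup D.graph.Hat)
    (hJhat : ∀ i (y : D.DeltaHat), (y : D.PiHat) ∈ Tw.Jhat i ↔ D.ρHat y ∈ V i) (hVn : ∀ i, (V i).Normal)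
    (hVo : ∀ i, IsOpen (V i : Set D.graph.Hat)) (hV : ∀ O ∈ 𝓝 (1 : D.graph.Hat), ∃ i, (V i : Set D.graph.Hat) ⊆ O)
    (Cv : Tw.CoveringLevelGraphs) (Ad : ∀ i, Cv.toLevelData.LevelDatum i) (h23vi : ∀ i, (Ad i).lev.Cor23vi)
    (hst : ∀ i (γ : D.DeltaTp), (∀ v ∈ Cv.toLevelData.compH i, Cv.toLevelData.act i (γ : D.PiTp) v ∈
        Cv.toLevelData.compH i) → ∃ ĥ ∈ D.graph.HatH, ĥ⁻¹ * D.graph.ι (D.ρTp γ) ∈ V i)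
    (hdense : (D.graph.HatH : Set D.graph.Hat) ⊆ closure ((D.graph.TpH.map D.graph.ι : Subgroup D.graph.Hat) : Set _))
    (hHatH : IsClosed (D.graph.HatH : Set D.graph.Hat)) (h23vD : D.Cor23v)
    (hlevV : ∀ i, Tw.Jhat i ≤ (W.hat.subgroupOf W.pmHat).map A.eHat.toMonoidHom)
    (hinf : W.piPM ⊓ W.hat ≤ W.piV)
    (hrel₂ : ∀ I, C.IsCuspidalInertia W.piV I →
      ∃ I', C.IsCuspidalInertia W.piPM I' ∧ ((I' ⊓ W.piV).subgroupOf I').FiniteIndex ∧ I = I' ⊓ W.piV)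
    {I : Subgroup W.Corhat} (hI : C.IsCuspidalInertia W.piV I) (hIΔ : I ≤ W.deltaBox H) :
    ∀ γ' : W.Corhat, γ' ∈ W.piPM ⊓ W.aug.ker →
      I.map (MulAut.conj γ').toMonoidHom ≤ W.pmBox H → γ' ∈ W.deltaPmBox H :=
  A.mem_deltaPmBox_of_coveringLevelGraphs_of_hrel₂ Dic Tw Cv Ad h23vi (Tw.levelsNormal_of_graphLevels V hJhat hVn)
    (Cv.toLevelData.stabLeDeltaHLevel_of_graphLevels V hJhat hVo hdense hst)
    (Tw.images_shrink_of_graphLevels V hJhat hV) hHatH h23vD hlevV hinf hrel₂ hI hIΔ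

end Relaxed

/-! ## § 2. At an agreement with a special-fibre datum: the fused inputs (B)+(C) over an admissible tower of the sub-graph datum -/

section SpecialFibre

variable {S : BadPlaceSetting.{0}} {P : TopGroup.{0}} {T : TemperedCoverings S P} {W : PlusMinusTower T}
  {Cu : CuspidalInertiaData W}
  {p : ℕ} [Fact p.Prime] {X : TemperedCurve p} {d : X.GroupLevelData}
  {Sf : SpecialFibreData (X.toTemperedArithmeticGroup d)} {h36 : Sf.Gc.Prop36Hypotheses}
  {Sigma SigmaHat : Set ℕ} {hsub : Sigma ⊆ SigmaHat} {hne : Sigma.Nonempty}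
  {hprime : ∀ q ∈ SigmaHat, q.Prime} {hp : p ∉ Sigma} {TpH : Subgroup Sf.chart.G}
  {HatH : Subgroup (TemperedGraphGroupData.exists_completion_of_prop36 Sf.Gc h36 Sf.chart).choose}
  {hle : TpH.map (TemperedGraphGroupData.exists_completion_of_prop36 Sf.Gc h36
    Sf.chart).choose_spec.choose.toMonoidHom ≤ HatH}
  {cMH : {x : X.Pt // X.IsCusp x} → Prop}

/-- **Inputs (B)+(C) of [IUTchII] Cor 2.4 (i), FUSED, at an agreement with a special-fibre datum** (kurims p. 70 l. −2 – p. 71 l. 5): for a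
tower `W` with the transported cuspidal datum (`hlev`), `[Π^±_v : Π_v] < ∞` (`hfi`), `Π^±_v ∩ Π̂_v ⊆ Π_v` (`hinf`), a bicontinuous agreement `A`
with `ofSpecialFibre X d Sf … TpH HatH hle cMH`, a `Π_v`-cuspidal `I_t ⊆ Δ_{v□}` and a `Π_{v□} ⊆ Π_v` whose `Δ^±_{v□}` is carried by `eHat` onto
`Δ^tp_{X,ℍ'}` (`hDic`) for a sub-graph `Π^tp_{ℍ'}` with `Π̂_{ℍ'}` its closure (`hH'`): «for `γ' ∈ Δ^±_v`, `I^{γ'}_t ⊆ Π^±_{v□} ⟹ γ' ∈ Δ^±_{v□}`»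
MODULO the NAMED data of that datum — [IUTchI] Cor 2.3 (v) (`h23v'`), an ADMISSIBLE tower `Tw` (levels `ρ̂⁻¹(V_i)`, `V_i ⊴ Π̂_𝔾` open, shrinking
to `1`) realised by coverings of semi-graphs `Cv` whose level data `Ad` satisfy [IUTchI] Cor 2.3 (vi) BY NAME (`h23vi`), the (D3) stabiliser
statement (`hst`), and «levels below `Π̂_v`» (`hlevV`).  DISCHARGED here: the re-graphing of the agreement to `ℍ'`, conjunct 2 of Def 2.3 (ii)′,
the density `Π^tp_{ℍ'} ↪ Π̂_{ℍ'}` and the closedness of `Π̂_{ℍ'}`.  PROVED (`mem_deltaPmBox_of_graphTower_of_hrel₂`).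
([IUTchII] Cor 2.4 (i), kurims pp.70–71) [claim: Mochizuki2012, status: disputed] -/
theorem hBC_ofSpecialFibre_graphTower (hfi : (W.piV.subgroupOf W.piPM).index ≠ 0)
    (hlev : ∀ (Q I : Subgroup W.Corhat), Cu.IsCuspidalInertia Q I ↔
      I ≤ Q ∧ ∃ I₀ : Subgroup W.Corhat, Cu.IsCuspidalInertia W.piPM I₀ ∧ I = I₀ ⊓ Q)
    (hinf : W.piPM ⊓ W.hat ≤ W.piV)
    (A : StableCurveAgreement W Cu
      (StableCurveTemperedData.ofSpecialFibre X d Sf h36 Sigma SigmaHat hsub hne hprime hp TpH HatH hle cMH))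
    (hA : IsHomeomorph A.eHat) {H : Subgroup P} (TpH' : Subgroup Sf.chart.G)
    (HatH' : Subgroup (TemperedGraphGroupData.exists_completion_of_prop36 Sf.Gc h36 Sf.chart).choose)
    (hle' : TpH'.map (TemperedGraphGroupData.exists_completion_of_prop36 Sf.Gc h36
      Sf.chart).choose_spec.choose.toMonoidHom ≤ HatH')
    (cMH' : {x : X.Pt // X.IsCusp x} → Prop)
    (hH' : ((StableCurveTemperedData.ofSpecialFibre X d Sf h36 Sigma SigmaHat hsub hne hprime hp TpH' HatH' hle' cMH').graph.HatH :
        Set (StableCurveTemperedData.ofSpecialFibre X d Sf h36 Sigma SigmaHat hsub hne hprime hp TpH' HatH' hle' cMH').graph.Hat) =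
      closure ((StableCurveTemperedData.ofSpecialFibre X d Sf h36 Sigma SigmaHat hsub hne hprime hp TpH' HatH' hle' cMH').graph.ι ''
        (StableCurveTemperedData.ofSpecialFibre X d Sf h36 Sigma SigmaHat hsub hne hprime hp TpH' HatH' hle' cMH').graph.TpH))
    (hDic : ((W.deltaPmBox H).subgroupOf W.pmHat).map A.eHat.toMonoidHom =
      ((StableCurveTemperedData.ofSpecialFibre X d Sf h36 Sigma SigmaHat hsub hne hprime hp TpH' HatH' hle' cMH').deltaTpH.map
        (StableCurveTemperedData.ofSpecialFibre X d Sf h36 Sigma SigmaHat hsub hne hprime hp TpH' HatH' hle' cMH').ιΔ).map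
        (StableCurveTemperedData.ofSpecialFibre X d Sf h36 Sigma SigmaHat hsub hne hprime hp TpH' HatH' hle' cMH').DeltaHat.subtype)
    (h23v' : (StableCurveTemperedData.ofSpecialFibre X d Sf h36 Sigma SigmaHat hsub hne hprime hp TpH' HatH' hle' cMH').Cor23v)
    (Tw : (StableCurveTemperedData.ofSpecialFibre X d Sf h36 Sigma SigmaHat hsub hne hprime hp TpH' HatH' hle' cMH').Prop24Tower)
    (V : Tw.I → Subgroup (StableCurveTemperedData.ofSpecialFibre X d Sf h36 Sigma SigmaHat hsub hne hprime hp TpH' HatH' hle' cMH').graph.Hat)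
    (hJhat : ∀ i (y : (StableCurveTemperedData.ofSpecialFibre X d Sf h36 Sigma SigmaHat hsub hne hprime hp TpH' HatH' hle' cMH').DeltaHat),
      (y : (StableCurveTemperedData.ofSpecialFibre X d Sf h36 Sigma SigmaHat hsub hne hprime hp TpH' HatH' hle' cMH').PiHat) ∈ Tw.Jhat i ↔
        (StableCurveTemperedData.ofSpecialFibre X d Sf h36 Sigma SigmaHat hsub hne hprime hp TpH' HatH' hle' cMH').ρHat y ∈ V i)
    (hVn : ∀ i, (V i).Normal)
    (hVo : ∀ i, IsOpen (V i : Set (StableCurveTemperedData.ofSpecialFibre X d Sf h36 Sigma SigmaHat hsub hne hprime hp TpH' HatH' hle' cMH').graph.Hat))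
    (hV : ∀ O ∈ 𝓝 (1 : (StableCurveTemperedData.ofSpecialFibre X d Sf h36 Sigma SigmaHat hsub hne hprime hp TpH' HatH' hle' cMH').graph.Hat),
      ∃ i, (V i : Set _) ⊆ O)
    (Cv : Tw.CoveringLevelGraphs) (Ad : ∀ i, Cv.toLevelData.LevelDatum i) (h23vi : ∀ i, (Ad i).lev.Cor23vi)
    (hst : ∀ i (γ : (StableCurveTemperedData.ofSpecialFibre X d Sf h36 Sigma SigmaHat hsub hne hprime hp TpH' HatH' hle' cMH').DeltaTp),
      (∀ v ∈ Cv.toLevelData.compH i, Cv.toLevelData.act i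
        (γ : (StableCurveTemperedData.ofSpecialFibre X d Sf h36 Sigma SigmaHat hsub hne hprime hp TpH' HatH' hle' cMH').PiTp) v ∈
          Cv.toLevelData.compH i) →
        ∃ ĥ ∈ (StableCurveTemperedData.ofSpecialFibre X d Sf h36 Sigma SigmaHat hsub hne hprime hp TpH' HatH' hle' cMH').graph.HatH,
          ĥ⁻¹ * (StableCurveTemperedData.ofSpecialFibre X d Sf h36 Sigma SigmaHat hsub hne hprime hp TpH' HatH' hle' cMH').graph.ι
            ((StableCurveTemperedData.ofSpecialFibre X d Sf h36 Sigma SigmaHat hsub hne hprime hp TpH' HatH' hle' cMH').ρTp γ) ∈ V i)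
    (hlevV : ∀ i, Tw.Jhat i ≤ (W.hat.subgroupOf W.pmHat).map A.eHat.toMonoidHom)
    {I : Subgroup W.Corhat} (hI : Cu.IsCuspidalInertia W.piV I) (hIΔ : I ≤ W.deltaBox H) :
    ∀ γ' : W.Corhat, γ' ∈ W.piPM ⊓ W.aug.ker →
      I.map (MulAut.conj γ').toMonoidHom ≤ W.pmBox H → γ' ∈ W.deltaPmBox H := by
  have hHatH : IsClosed ((StableCurveTemperedData.ofSpecialFibre X d Sf h36 Sigma SigmaHat hsub hne hprime hp TpH' HatH' hle' cMH').graph.HatH :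
      Set (StableCurveTemperedData.ofSpecialFibre X d Sf h36 Sigma SigmaHat hsub hne hprime hp TpH' HatH' hle' cMH').graph.Hat) := by
    rw [hH']; exact isClosed_closure
  have hdense : ((StableCurveTemperedData.ofSpecialFibre X d Sf h36 Sigma SigmaHat hsub hne hprime hp TpH' HatH' hle' cMH').graph.HatH :
      Set (StableCurveTemperedData.ofSpecialFibre X d Sf h36 Sigma SigmaHat hsub hne hprime hp TpH' HatH' hle' cMH').graph.Hat) ⊆
      closure (((StableCurveTemperedData.ofSpecialFibre X d Sf h36 Sigma SigmaHat hsub hne hprime hp TpH' HatH' hle' cMH').graph.TpH.map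
        (StableCurveTemperedData.ofSpecialFibre X d Sf h36 Sigma SigmaHat hsub hne hprime hp TpH' HatH' hle' cMH').graph.ι : Subgroup _) : Set _) := by
    rw [Subgroup.coe_map, hH']
  exact mem_deltaPmBox_of_graphTower_of_hrel₂
    (D := StableCurveTemperedData.ofSpecialFibre X d Sf h36 Sigma SigmaHat hsub hne hprime hp TpH' HatH' hle' cMH')
    { eHat := A.eHat, map_piPM := A.map_piPM, mem_ker_iff := A.mem_ker_iff, inertia_iff := A.inertia_iff }
    { deltaPmBox_eq := hDic, isHomeomorph := hA } Tw V hJhat hVn hVo hV Cv Ad h23vi hst hdense hHatH h23v' hlevV hinf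
    (W.hrel₂_of_levelClause hfi Cu hlev) hI hIΔ

/-- **[IUTchII] Cor 2.4 (i) (landed predicate `Cor24_i W Cu H I`) at an agreement with a special-fibre datum, (B) over an admissible tower**:
input (A) from part 1 (`inputA_ofSpecialFibre`, MODULO [IUTchI] Prop 2.4 (i) of the datum) and the fused (B)+(C) from
`hBC_ofSpecialFibre_graphTower` (MODULO the sub-graph datum's Δ-dictionary, Cor 2.3 (v), admissible tower with Cor 2.3 (vi) by name, (D3),
levels below `Π̂_v`) — via abc-iut-w5-d121's `cor24_i_of_inputs_mem`.  PROVED. ([IUTchII] Cor 2.4 (i), kurims pp.69–71) [claim: Mochizuki2012, status: disputed] -/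
theorem cor24_i_ofSpecialFibre_graphTower (hfi : (W.piV.subgroupOf W.piPM).index ≠ 0)
    (hlev : ∀ (Q I : Subgroup W.Corhat), Cu.IsCuspidalInertia Q I ↔
      I ≤ Q ∧ ∃ I₀ : Subgroup W.Corhat, Cu.IsCuspidalInertia W.piPM I₀ ∧ I = I₀ ⊓ Q)
    (hinf : W.piPM ⊓ W.hat ≤ W.piV)
    (A : StableCurveAgreement W Cu
      (StableCurveTemperedData.ofSpecialFibre X d Sf h36 Sigma SigmaHat hsub hne hprime hp TpH HatH hle cMH))
    (hA : IsHomeomorph A.eHat)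
    (h24i : (StableCurveTemperedData.ofSpecialFibre X d Sf h36 Sigma SigmaHat hsub hne hprime hp TpH HatH hle cMH).Prop24i)
    (I : Subgroup W.Corhat) {H : Subgroup P} (TpH' : Subgroup Sf.chart.G)
    (HatH' : Subgroup (TemperedGraphGroupData.exists_completion_of_prop36 Sf.Gc h36 Sf.chart).choose)
    (hle' : TpH'.map (TemperedGraphGroupData.exists_completion_of_prop36 Sf.Gc h36
      Sf.chart).choose_spec.choose.toMonoidHom ≤ HatH')
    (cMH' : {x : X.Pt // X.IsCusp x} → Prop)
    (hH' : ((StableCurveTemperedData.ofSpecialFibre X d Sf h36 Sigma SigmaHat hsub hne hprime hp TpH' HatH' hle' cMH').graph.HatH :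
        Set (StableCurveTemperedData.ofSpecialFibre X d Sf h36 Sigma SigmaHat hsub hne hprime hp TpH' HatH' hle' cMH').graph.Hat) =
      closure ((StableCurveTemperedData.ofSpecialFibre X d Sf h36 Sigma SigmaHat hsub hne hprime hp TpH' HatH' hle' cMH').graph.ι ''
        (StableCurveTemperedData.ofSpecialFibre X d Sf h36 Sigma SigmaHat hsub hne hprime hp TpH' HatH' hle' cMH').graph.TpH))
    (hDic : ((W.deltaPmBox H).subgroupOf W.pmHat).map A.eHat.toMonoidHom =
      ((StableCurveTemperedData.ofSpecialFibre X d Sf h36 Sigma SigmaHat hsub hne hprime hp TpH' HatH' hle' cMH').deltaTpH.map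
        (StableCurveTemperedData.ofSpecialFibre X d Sf h36 Sigma SigmaHat hsub hne hprime hp TpH' HatH' hle' cMH').ιΔ).map
        (StableCurveTemperedData.ofSpecialFibre X d Sf h36 Sigma SigmaHat hsub hne hprime hp TpH' HatH' hle' cMH').DeltaHat.subtype)
    (h23v' : (StableCurveTemperedData.ofSpecialFibre X d Sf h36 Sigma SigmaHat hsub hne hprime hp TpH' HatH' hle' cMH').Cor23v)
    (Tw : (StableCurveTemperedData.ofSpecialFibre X d Sf h36 Sigma SigmaHat hsub hne hprime hp TpH' HatH' hle' cMH').Prop24Tower)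
    (V : Tw.I → Subgroup (StableCurveTemperedData.ofSpecialFibre X d Sf h36 Sigma SigmaHat hsub hne hprime hp TpH' HatH' hle' cMH').graph.Hat)
    (hJhat : ∀ i (y : (StableCurveTemperedData.ofSpecialFibre X d Sf h36 Sigma SigmaHat hsub hne hprime hp TpH' HatH' hle' cMH').DeltaHat),
      (y : (StableCurveTemperedData.ofSpecialFibre X d Sf h36 Sigma SigmaHat hsub hne hprime hp TpH' HatH' hle' cMH').PiHat) ∈ Tw.Jhat i ↔
        (StableCurveTemperedData.ofSpecialFibre X d Sf h36 Sigma SigmaHat hsub hne hprime hp TpH' HatH' hle' cMH').ρHat y ∈ V i)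
    (hVn : ∀ i, (V i).Normal)
    (hVo : ∀ i, IsOpen (V i : Set (StableCurveTemperedData.ofSpecialFibre X d Sf h36 Sigma SigmaHat hsub hne hprime hp TpH' HatH' hle' cMH').graph.Hat))
    (hV : ∀ O ∈ 𝓝 (1 : (StableCurveTemperedData.ofSpecialFibre X d Sf h36 Sigma SigmaHat hsub hne hprime hp TpH' HatH' hle' cMH').graph.Hat),
      ∃ i, (V i : Set _) ⊆ O)
    (Cv : Tw.CoveringLevelGraphs) (Ad : ∀ i, Cv.toLevelData.LevelDatum i) (h23vi : ∀ i, (Ad i).lev.Cor23vi)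
    (hst : ∀ i (γ : (StableCurveTemperedData.ofSpecialFibre X d Sf h36 Sigma SigmaHat hsub hne hprime hp TpH' HatH' hle' cMH').DeltaTp),
      (∀ v ∈ Cv.toLevelData.compH i, Cv.toLevelData.act i
        (γ : (StableCurveTemperedData.ofSpecialFibre X d Sf h36 Sigma SigmaHat hsub hne hprime hp TpH' HatH' hle' cMH').PiTp) v ∈
          Cv.toLevelData.compH i) →
        ∃ ĥ ∈ (StableCurveTemperedData.ofSpecialFibre X d Sf h36 Sigma SigmaHat hsub hne hprime hp TpH' HatH' hle' cMH').graph.HatH,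
          ĥ⁻¹ * (StableCurveTemperedData.ofSpecialFibre X d Sf h36 Sigma SigmaHat hsub hne hprime hp TpH' HatH' hle' cMH').graph.ι
            ((StableCurveTemperedData.ofSpecialFibre X d Sf h36 Sigma SigmaHat hsub hne hprime hp TpH' HatH' hle' cMH').ρTp γ) ∈ V i)
    (hlevV : ∀ i, Tw.Jhat i ≤ (W.hat.subgroupOf W.pmHat).map A.eHat.toMonoidHom) :
    Literature.IUT.HodgeArakelov.Cor24_i W Cu H I :=
  cor24_i_of_inputs_mem W Cu H I
    (fun hI' hIΔ => A.inputA_ofSpecialFibre hfi hlev h24i hI' (hIΔ.trans (inf_le_right : W.deltaBox H ≤ W.aug.ker)))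
    (fun hI' hIΔ => A.hBC_ofSpecialFibre_graphTower hfi hlev hinf hA TpH' HatH' hle' cMH' hH' hDic h23v' Tw V hJhat hVn hVo hV Cv Ad
      h23vi hst hlevV hI' hIΔ)

end SpecialFibre

end StableCurveAgreement

end PlusMinusTower

end Literature.IUT.HodgeArakelov

end
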